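import Summits.QuantumAdvantage.QuantumAdvantage.Theorems.MobiusLadderDigitPolyUniformityShiftInvariant

/-!
# Crux `DigitPolyUniformity` (stmt-QuantumAdvantage-1392), line `Sketch` (LAR composition):
# doubling-invariant weights (digit-sum weights of ANY modulus) correlate at most `1/3` with `λ`

Stub Z4 of line Sketch/LAR (seat c4, wave 4). The abstract `1/3` law
`ShiftInvariant.three_mul_abs_sum_le` (`Theorems/…ShiftInvariant`, p134783) applied to a weight
`φ : ℕ → 𝔽₂` with `φ(2N) = φ(N)` for `2N < 2ⁿ`: `3·|Σ_{N<2ⁿ} λ(N) (−1)^{φ(N)}| ≤ 2ⁿ + 1`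
(`liouville_weight_corr_le_of_doubling`). Instance: `φ(N) = g(s₂(N) mod m)` for ANY modulus `m` and any
`g` (`liouville_digitSumWeight_corr_le`), since the binary digit sum is doubling-invariant
(`DoublingWeight.digits_sum_two_mul`). Unconditional and uniform in `m`; seat c3's `…AutomaticClasses`
(`digitPolyUniformity_digitSum`, p131914) gives `o(1)` for FIXED `m` modulo Müllner's theorem.
-/

namespace Summit.QuantumAdvantage.DigitPolyUniformity.SketchLAR

open Finset
open Literature.NumberTheory.LFunctions.Green2012 (liouville_two_mul)
open Summit.QuantumAdvantage.QuantumAdvantage.Theorems.MobiusLadder (abs_cast_liouville_le_one)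

/-- **Stub Z4 (doubling-invariant weights).** For every weight `φ : ℕ → 𝔽₂` with `φ(2N) = φ(N)`
whenever `2N < 2ⁿ`, `3·|Σ_{N<2ⁿ} λ(N) (−1)^{φ(N)}| ≤ 2ⁿ + 1`: the summand `a(N) = λ(N)(−1)^{φ(N)}`
is `1`-bounded and anti-doubling (`λ(2N) = −λ(N)`), so the `1/3` law for anti-doubling sequences
applies. [folklore] -/
theorem liouville_weight_corr_le_of_doubling {n : ℕ} (φ : ℕ → ZMod 2)
    (hφ : ∀ N : ℕ, 2 * N < 2 ^ n → φ (2 * N) = φ N) :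
    3 * |∑ N ∈ Finset.range (2 ^ n), ((ArithmeticFunction.liouville N : ℤ) : ℝ) *
        (if φ N = 1 then (-1 : ℝ) else 1)| ≤ (2 : ℝ) ^ n + 1 := by
  refine ShiftInvariant.three_mul_abs_sum_le
    (fun N => ((ArithmeticFunction.liouville N : ℤ) : ℝ) * (if φ N = 1 then (-1 : ℝ) else 1))
    n ?_ ?_ n le_rfl
  · intro N hN
    rw [hφ N hN, liouville_two_mul, Int.cast_neg, neg_mul]
  · intro N
    rw [abs_mul]
    have h1 := abs_cast_liouville_le_one N
    have h2 : |(if φ N = 1 then (-1 : ℝ) else 1)| = 1 := by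
      split_ifs <;> simp
    rw [h2, mul_one]
    exact h1

namespace DoublingWeight

/-- The binary digit sum is invariant under doubling: `s₂(2N) = s₂(N)`. [folklore] -/
theorem digits_sum_two_mul (N : ℕ) : (Nat.digits 2 (2 * N)).sum = (Nat.digits 2 N).sum := by
  rcases Nat.eq_zero_or_pos N with rfl | hN
  · simp
  · rw [Nat.digits_def' (by norm_num : 1 < 2) (by omega : 0 < 2 * N)]
    rw [Nat.mul_mod_right, Nat.mul_div_cancel_left N (by norm_num : 0 < 2)]
    simp

end DoublingWeight

/-- **Digit-sum weights of any modulus correlate at most `1/3 + o(1)` with `λ`, unconditionally.**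
For all `n, m` and every `g : ℕ → 𝔽₂`,
`3·|Σ_{N<2ⁿ} λ(N) (−1)^{g(s₂(N) mod m)}| ≤ 2ⁿ + 1`. [folklore] -/
theorem liouville_digitSumWeight_corr_le (n m : ℕ) (g : ℕ → ZMod 2) :
    3 * |∑ N ∈ Finset.range (2 ^ n), ((ArithmeticFunction.liouville N : ℤ) : ℝ) *
        (if g ((Nat.digits 2 N).sum % m) = 1 then (-1 : ℝ) else 1)| ≤ (2 : ℝ) ^ n + 1 :=
  liouville_weight_corr_le_of_doubling (n := n) (fun N => g ((Nat.digits 2 N).sum % m))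
    fun N _ => by simp only [DoublingWeight.digits_sum_two_mul]

end Summit.QuantumAdvantage.DigitPolyUniformity.SketchLAR
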